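import Mathlib.Analysis.Complex.ExponentialBounds
import Literature.IUT.LogVolume.Theorem110
import HarnessLib

/-!
# The fork at [IUTchIII] Corollary 3.12 — checks: the hypotheses of the [IUTchIV] Theorem 1.10 chain are
# jointly satisfiable (non-vacuity)

Record-only file (D-0012) of the abc-iut cell; TAKES NO SIDE. `Literature/IUT/LogVolume/Theorem110.lean`
proves `theorem110 : ProofData → IsEtaPrm η_prm → l ≠ 5 → Cor312 → (C_Θ admissible ∧ C_Θ ≥ −1 ∧
Display ∧ DisplayF)` for numerics `X : Thm110Numerics`. A conditional theorem whose hypotheses were jointly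
UNSATISFIABLE would be vacuous. This file exhibits a toy instance — `l = 7`, `d_mod = e_mod = 1`, all
log-differents/conductors `0`, `log(q) = 1`, `−|log(Θ)| := −|log(q)| = −1/14`, and `η_prm` := a witness
of Prop. 1.6 (the tree proves one exists) — carrying `ProofData`, satisfying `Cor312` (with equality),
`IsEtaPrm η_prm` and `l ≠ 5` simultaneously (`hypotheses_satisfiable`). The toy numbers are NOT the
invariants of any elliptic curve; the point is only the logical consistency of the hypothesis structures
(referee vacuity check), in the spirit of the skeleton's `ForkChecks.lean`.
-/

noncomputable section

namespace Summit.ABC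

namespace IUTFork

open Literature.IUT.LogVolume

/-- Toy numerics: `l = 7`, `d_mod = e_mod = 1`, `η_prm = η`, all `log(𝔡)`, `log(𝔣)` zero, `log(q) = 1`,
`−|log(Θ)| = −1/14 = −|log(q)|`. [claim: Mochizuki2012, status: disputed] -/
def toyNumerics (η : ℝ) (hη : 0 < η) : Thm110Numerics where
  l := 7
  prime_l := by norm_num
  five_le_l := by norm_num
  dmod := 1
  one_le_dmod := le_rfl
  emod := 1
  one_le_emod := le_rfl
  emod_le_dmod := le_rfl
  etaPrm := η
  etaPrm_pos := hη
  logDiffTpd := 0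
  logDiffTpd_nonneg := le_rfl
  logCondTpd := 0
  logCondTpd_nonneg := le_rfl
  logDiffF := 0
  logDiffF_nonneg := le_rfl
  logCondF := 0
  logCondF_nonneg := le_rfl
  logq := 1
  logq_pos := one_pos
  negLogTheta := -(1 / 14)

/-- Toy proof data for the toy numerics: all of `log(𝔡^K)`, `log(𝔣^K)`, `log(𝔰^ℚ)`, `log(𝔰^≤)` zero; the
six printed inequalities then hold numerically (`hull_le` reads `−1/14 ≤ −1/3 + 3·log(π)`).
[claim: Mochizuki2012, status: disputed] -/
def toyProofData (η : ℝ) (hη : 0 < η) : (toyNumerics η hη).ProofData where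
  logDiffK := 0
  logDiffK_nonneg := le_rfl
  logCondK := 0
  logCondK_nonneg := le_rfl
  logsQ := 0
  logsQ_nonneg := le_rfl
  logsLe := 0
  logsLe_nonneg := le_rfl
  tpd_le_F := by simp [toyNumerics]
  F_le := by
    simp only [toyNumerics, add_zero, zero_add]
    exact Real.log_nonneg (by norm_num)
  K_le := by
    simp only [toyNumerics, add_zero, zero_add]
    have : (0 : ℝ) ≤ Real.log ((7 : ℕ) : ℝ) := Real.log_nonneg (by norm_num)
    linarith
  sQ_le := by
    simp only [toyNumerics]
    have : (0 : ℝ) ≤ Real.log (2 * 3 * 5 * ((7 : ℕ) : ℝ)) := Real.log_nonneg (by norm_num)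
    simpa using this
  sLe_le := by positivity
  hull_le := by
    simp only [toyNumerics]
    have hpi : 1 ≤ Real.log Real.pi := by
      rw [← Real.log_exp 1]
      exact Real.log_le_log (Real.exp_pos 1)
        (by have := Real.exp_one_lt_d9; linarith [Real.pi_gt_three])
    norm_num
    nlinarith

/-- The toy numerics satisfy `Cor312` (with equality: `−|log(q)| = −(1/(2·7))·1 = −1/14 = −|log(Θ)|`).
[claim: Mochizuki2012, status: disputed] -/
theorem toy_cor312 (η : ℝ) (hη : 0 < η) : (toyNumerics η hη).Cor312 := by
  unfold Thm110Numerics.Cor312 Thm110Numerics.absLogq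
  simp [toyNumerics]
  norm_num

/-- **Non-vacuity of the Theorem 1.10 chain**: there are numerics carrying proof data and satisfying
`Cor312`, `IsEtaPrm η_prm` (Prop. 1.6, proved in the tree) and `l ≠ 5` simultaneously — so the hypotheses of
`Thm110Numerics.theorem110` are jointly satisfiable and its conclusion holds for this instance.
[claim: Mochizuki2012, status: disputed] -/
theorem hypotheses_satisfiable : ∃ X : Thm110Numerics,
    Nonempty X.ProofData ∧ X.Cor312 ∧ IsEtaPrm X.etaPrm ∧ X.l ≠ 5 ∧
      (X.CThetaAdmissible ∧ -1 ≤ X.CTheta ∧ X.Display ∧ X.DisplayF) := by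
  obtain ⟨η, hη⟩ := exists_isEtaPrm
  refine ⟨toyNumerics η hη.1, ⟨toyProofData η hη.1⟩, toy_cor312 η hη.1, hη, by simp [toyNumerics], ?_⟩
  exact Thm110Numerics.theorem110 (toyProofData η hη.1) hη (by simp [toyNumerics]) (toy_cor312 η hη.1)

end IUTFork

end Summit.ABC

end
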